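import Literature.Barriers.Parity.LinearSieveOptimalityPartialSummation
import Literature.NumberTheory.LFunctions.PrimeCountingThetaRatio
import Literature.NumberTheory.Sieve.EulerMascheroniEin
import HarnessLib

/-!
# `LinearSieveOptimality` — companion file: base cases and normalisations for Theorem 4.5.1.1

Topic `Literature/Barriers/Parity`, companion of the catalogue entry `LinearSieveOptimality.lean`
(Selberg's extremal examples for the linear sieve, Greaves 2001 §4.5.1). Everything is PROVED
(no definitions, no named facts). The Buchstab induction proving Greaves' Theorem 4.5.1.1 is
run (file `LinearSieveOptimalityInduction.lean`) in the normalisation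
`𝓕_r(X, s) = S(𝒜^{(−)^r}(X), P(X^{1/s})) · log X / X → G_r(s) = e^{−γ} s φ_r(s)`; this file
supplies

* the uniformity principle `eventually_forall_abs_sub_le_of_monotoneOn`: pointwise convergence
  of functions monotone in `t` to a continuous limit is uniform on compact `t`-intervals (used
  because `t ↦ 𝓕_r(X, t)` is non-decreasing);
* Mertens' product theorem for the primes STRICTLY below `y`,
  `log y · V(P(y)) → e^{−γ}` (`tendsto_log_mul_unitDensityProduct`; tree:
  `Literature.NumberTheory.LFunctions.Mertens.tendsto_log_mul_prod_one_sub_inv` for `p ≤ x`), and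
  along `y = X^{1/s}`: `log X · V(P(X^{1/s})) → s e^{−γ}`;
* the prime number theorem for `#{p < y}` and for the primes in `[2X, 4X)`:
  `#{p prime : 2X ≤ p < 4X} · log X / X → 2`;
* the values `G_0(s) = 2` (`s ≤ 3`) and `G_1(s) = 0` (`s ≤ 2`) (`A₁ = 2e^γ`, tree:
  `Literature.NumberTheory.Sieve.rosserAdjointP_one_one`);
* the BASE CASES of the induction (Greaves' "Special Situation", p. 123–124, and its boundary
  case `s = 2`): `𝓕_1(X, s) → 0` for `1 ≤ s < 2` (no survivors) and for `s = 2` (semiprimes,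
  `≤ π(4√X)²` by `selbergSet_one_sifted_le_sq` and Chebyshev's bound), and `𝓕_0(X, s) → 2` for
  `1 ≤ s < 3` (the survivors are the primes in `[2X, 4X)`).

## References

* G. Greaves, *Sieves in Number Theory*, Springer (2001), §4.5.1 pp. 123–124 [Greaves2001].
* G. H. Hardy, E. M. Wright, *An Introduction to the Theory of Numbers*, Thm 429 [HardyWright2008].
-/

noncomputable section

open Filter Finset
open scoped Topology ArithmeticFunction.Omega

namespace Literature.Barriers.Parity

open Literature.NumberTheory.Sieve (primesProdBelow primeFactors_primesProdBelow)

/-! ### Uniformity from monotonicity -/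

/-- **Pointwise convergence of monotone functions to a continuous limit is locally uniform**: if
`t ↦ F_Y(t)` is non-decreasing on `[a, b]` for all large `Y`, `g` is continuous on `[a, b]` and
`F_Y(t) → g(t)` for every `t ∈ [a, b]`, then `sup_{[a,b]} |F_Y − g| → 0`: for every `ε > 0`,
eventually `|F_Y(u) − g(u)| ≤ ε` for all `u ∈ [a, b]` (compare `F_Y(u)` with its values at the two
neighbouring points of a fine grid). [folklore] -/
theorem eventually_forall_abs_sub_le_of_monotoneOn {F : ℝ → ℝ → ℝ} {g : ℝ → ℝ} {a b : ℝ}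
    (hab : a < b) (hmono : ∀ᶠ Y in atTop, MonotoneOn (F Y) (Set.Icc a b))
    (hg : ContinuousOn g (Set.Icc a b))
    (hlim : ∀ t ∈ Set.Icc a b, Tendsto (fun Y => F Y t) atTop (𝓝 (g t))) {ε : ℝ} (hε : 0 < ε) :
    ∀ᶠ Y in atTop, ∀ u ∈ Set.Icc a b, |F Y u - g u| ≤ ε := by
  obtain ⟨δ, hδ, hUC⟩ := Metric.uniformContinuousOn_iff_le.mp
    (isCompact_Icc.uniformContinuousOn_of_continuous hg) (ε / 2) (by positivity)
  obtain ⟨n, hn1, hnδ⟩ : ∃ n : ℕ, 1 ≤ n ∧ (b - a) / n ≤ δ := by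
    refine ⟨⌈(b - a) / δ⌉₊ + 1, by omega, ?_⟩
    have h1 : (b - a) / δ ≤ ⌈(b - a) / δ⌉₊ := Nat.le_ceil _
    rw [div_le_iff₀ hδ] at h1
    rw [div_le_iff₀ (by positivity)]
    push_cast
    nlinarith
  have hn0 : (0 : ℝ) < n := by exact_mod_cast hn1
  set Δ : ℝ := (b - a) / n with hΔ
  have hΔ0 : 0 < Δ := div_pos (by linarith) hn0
  have hnΔ : (n : ℝ) * Δ = b - a := by rw [hΔ]; field_simp
  set t : ℕ → ℝ := fun i => a + i * Δ with htdef
  have htn : t n = b := by simp only [htdef]; linarith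
  have htsucc : ∀ i : ℕ, t (i + 1) - t i = Δ := fun i => by simp only [htdef]; push_cast; ring
  have htmem : ∀ i : ℕ, i ≤ n → t i ∈ Set.Icc a b := by
    intro i hi
    have hi' : (i : ℝ) ≤ n := by exact_mod_cast hi
    have h0 : (0 : ℝ) ≤ i := Nat.cast_nonneg i
    refine ⟨?_, ?_⟩
    · simp only [htdef]
      nlinarith
    · rw [← htn]
      simp only [htdef]
      nlinarith
  have hgrid : ∀ᶠ Y in atTop, ∀ i ∈ range (n + 1), |F Y (t i) - g (t i)| ≤ ε / 2 := by
    rw [eventually_all_finset]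
    intro i hi
    have hti := htmem i (Nat.lt_succ_iff.mp (mem_range.mp hi))
    filter_upwards [(Metric.tendsto_nhds.mp (hlim (t i) hti)) (ε / 2) (by positivity)] with Y hY
    rw [Real.dist_eq] at hY
    exact hY.le
  filter_upwards [hgrid, hmono] with Y hY hmY
  intro u hu
  set i : ℕ := ⌊(u - a) / Δ⌋₊ with hidef
  have hua : 0 ≤ (u - a) / Δ := div_nonneg (by linarith [hu.1]) hΔ0.le
  have hi1 : (i : ℝ) ≤ (u - a) / Δ := Nat.floor_le hua
  have hi2 : (u - a) / Δ < i + 1 := Nat.lt_floor_add_one _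
  have hti_le : t i ≤ u := by
    simp only [htdef]
    rw [le_div_iff₀ hΔ0] at hi1
    linarith
  have hu_lt : u < t (i + 1) := by
    simp only [htdef]
    rw [div_lt_iff₀ hΔ0] at hi2
    push_cast
    linarith
  by_cases hin : i < n
  · have hti := htmem i hin.le
    have hti1 := htmem (i + 1) hin
    have h1 := hY i (mem_range.mpr (by omega))
    have h2 := hY (i + 1) (mem_range.mpr (by omega))
    have hg1 : |g (t i) - g u| ≤ ε / 2 := by
      have hd : dist (t i) u ≤ δ := by
        rw [Real.dist_eq, abs_of_nonpos (by linarith)]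
        linarith [htsucc i]
      have := hUC (t i) hti u hu hd
      rwa [Real.dist_eq] at this
    have hg2 : |g (t (i + 1)) - g u| ≤ ε / 2 := by
      have hd : dist (t (i + 1)) u ≤ δ := by
        rw [Real.dist_eq, abs_of_pos (by linarith)]
        linarith [htsucc i]
      have := hUC (t (i + 1)) hti1 u hu hd
      rwa [Real.dist_eq] at this
    have hm1 : F Y (t i) ≤ F Y u := hmY hti hu hti_le
    have hm2 : F Y u ≤ F Y (t (i + 1)) := hmY hu hti1 hu_lt.le
    rw [abs_le] at h1 h2 hg1 hg2 ⊢
    constructor <;> linarith [h1.1, h1.2, h2.1, h2.2, hg1.1, hg1.2, hg2.1, hg2.2]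
  · push Not at hin
    have htni : t n ≤ t i := by
      simp only [htdef]
      have : (n : ℝ) ≤ i := by exact_mod_cast hin
      nlinarith
    have hub : u = b := le_antisymm hu.2 (by rw [← htn]; exact htni.trans hti_le)
    have h1 := hY n (mem_range.mpr (Nat.lt_succ_self n))
    rw [htn] at h1
    rw [hub]
    linarith [abs_nonneg (F Y b - g b)]

/-! ### Mertens' product theorem for the primes below `y` -/

/-- `V(P(y)) = ∏_{p < y} (1 − 1/p)`. [folklore] -/
theorem unitDensityProduct_primesProdBelow_eq (y : ℝ) :
    unitDensityProduct (primesProdBelow y) = ∏ p ∈ Nat.primesBelow ⌈y⌉₊, (1 - (p : ℝ)⁻¹) := by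
  rw [unitDensityProduct, primeFactors_primesProdBelow]
  exact prod_congr rfl fun p _ => by rw [one_div]

/-- **Mertens' product theorem, `p < y` form**: `log y · ∏_{p < y} (1 − 1/p) → e^{−γ}`
("Mertens' formula shows `V(P(z)) = (e^{−γ}/log z)(1 + O(1/log z))`"), from the tree's `p ≤ y`
form; the extra factor `∏_{p ≤ y, p ≥ y} (1 − 1/p)` is `1` or `1 − 1/⌊y⌋ → 1`.
[cite: HardyWright2008, Thm 429 (§22.8)] -/
theorem tendsto_log_mul_unitDensityProduct :
    Tendsto (fun y : ℝ => Real.log y * unitDensityProduct (primesProdBelow y)) atTop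
      (𝓝 (Real.exp (-Real.eulerMascheroniConstant))) := by
  have hfac : ∀ {y : ℝ} {p : ℕ}, p ∈ Nat.primesLE ⌊y⌋₊ \ Nat.primesBelow ⌈y⌉₊ →
      (2 : ℝ) ≤ p := fun {y p} hp => by
    have h1 := (Finset.mem_sdiff.mp hp).1
    change p ∈ Nat.primesBelow (⌊y⌋₊ + 1) at h1
    exact_mod_cast (Nat.mem_primesBelow.mp h1).2.two_le
  have hD : Tendsto (fun y : ℝ => ∏ p ∈ Nat.primesLE ⌊y⌋₊ \ Nat.primesBelow ⌈y⌉₊, (1 - (p : ℝ)⁻¹))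
      atTop (𝓝 1) := by
    have hsub1 : Tendsto (fun y : ℝ => y - 1) atTop atTop :=
      tendsto_atTop_atTop.mpr fun b => ⟨b + 1, fun y hy => by linarith⟩
    have hlow : Tendsto (fun y : ℝ => 1 - (y - 1)⁻¹) atTop (𝓝 1) := by
      have := (tendsto_inv_atTop_zero.comp hsub1).const_sub 1
      rw [sub_zero] at this
      exact this
    refine tendsto_of_tendsto_of_tendsto_of_le_of_le' hlow tendsto_const_nhds ?_ ?_
    · filter_upwards [eventually_ge_atTop 2] with y hy
      have hfl : y - 1 < ⌊y⌋₊ := Nat.sub_one_lt_floor y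
      have hinv : ((⌊y⌋₊ : ℕ) : ℝ)⁻¹ ≤ (y - 1)⁻¹ := inv_anti₀ (by linarith) hfl.le
      rcases Finset.subset_singleton_iff.mp (primesLE_floor_sdiff_subset (by linarith : (0 : ℝ) ≤ y))
        with h | h
      · simp only [h, prod_empty]
        have : 0 < (y - 1)⁻¹ := inv_pos.mpr (by linarith)
        linarith
      · simp only [h, prod_singleton]
        linarith
    · filter_upwards [eventually_ge_atTop 2] with y hy
      refine prod_le_one (fun p hp => ?_) (fun p hp => ?_)
      · have h2 := hfac hp
        rw [sub_nonneg]
        exact inv_le_one_of_one_le₀ (by linarith)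
      · have : (0 : ℝ) ≤ (p : ℝ)⁻¹ := inv_nonneg.mpr (Nat.cast_nonneg p)
        linarith
  have hmain := Literature.NumberTheory.LFunctions.Mertens.tendsto_log_mul_prod_one_sub_inv
  have h := hmain.div hD one_ne_zero
  rw [div_one] at h
  refine h.congr' ?_
  filter_upwards [eventually_ge_atTop 2] with y hy
  have hD0 : ∏ p ∈ Nat.primesLE ⌊y⌋₊ \ Nat.primesBelow ⌈y⌉₊, (1 - (p : ℝ)⁻¹) ≠ 0 := by
    refine prod_ne_zero_iff.mpr fun p hp => ?_
    have h2 := hfac hp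
    have : (p : ℝ)⁻¹ ≤ 1 / 2 := by
      rw [← one_div]
      exact one_div_le_one_div_of_le (by norm_num) h2
    linarith
  simp only [Pi.div_apply]
  rw [unitDensityProduct_primesProdBelow_eq, ← prod_sdiff (primesBelow_ceil_subset_primesLE_floor y),
    mul_comm (∏ p ∈ Nat.primesLE ⌊y⌋₊ \ Nat.primesBelow ⌈y⌉₊, (1 - (p : ℝ)⁻¹)) _, ← mul_assoc,
    mul_div_cancel_right₀ _ hD0]

/-- Along `y = X^{1/s}`: `log X · V(P(X^{1/s})) → s e^{−γ}` for `s > 0`.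
[cite: HardyWright2008, Thm 429 (§22.8)] -/
theorem tendsto_log_mul_unitDensityProduct_rpow {s : ℝ} (hs : 0 < s) :
    Tendsto (fun X : ℝ => Real.log X * unitDensityProduct (primesProdBelow (X ^ (1 / s)))) atTop
      (𝓝 (s * Real.exp (-Real.eulerMascheroniConstant))) := by
  have h := (tendsto_log_mul_unitDensityProduct.comp
    (tendsto_rpow_atTop (one_div_pos.mpr hs))).const_mul s
  refine h.congr' ?_
  filter_upwards [eventually_gt_atTop 0] with X hX
  simp only [Function.comp_apply]
  rw [Real.log_rpow hX]
  field_simp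

/-! ### The prime number theorem for `#{p < y}` and for the primes in `[2X, 4X)` -/

/-- `log y / y → 0`. [folklore] -/
theorem tendsto_log_div_self : Tendsto (fun y : ℝ => Real.log y / y) atTop (𝓝 0) := by
  have h := Real.tendsto_pow_log_div_mul_add_atTop 1 0 1 one_ne_zero
  refine h.congr fun y => ?_
  simp

/-- **`#{p < y} · log y / y → 1`** (the prime number theorem; tree:
`Literature.NumberTheory.LFunctions.tendsto_primeCounting_mul_log_div` for `π(⌊y⌋)`, which
exceeds `#{p < y}` by at most `1`). [folklore] -/
theorem tendsto_card_primesBelow_mul_log_div :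
    Tendsto (fun y : ℝ => (#(Nat.primesBelow ⌈y⌉₊) : ℝ) * Real.log y / y) atTop (𝓝 1) := by
  have hπ := Literature.NumberTheory.LFunctions.tendsto_primeCounting_mul_log_div
  have hdiff : Tendsto (fun y : ℝ => ((Nat.primeCounting ⌊y⌋₊ : ℝ) - #(Nat.primesBelow ⌈y⌉₊)) *
      Real.log y / y) atTop (𝓝 0) := by
    refine squeeze_zero' ?_ ?_ tendsto_log_div_self
    · filter_upwards [eventually_ge_atTop 1] with y hy
      have hle : #(Nat.primesBelow ⌈y⌉₊) ≤ Nat.primeCounting ⌊y⌋₊ := by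
        rw [← Nat.primesLE_card_eq_primeCounting]
        exact card_le_card (primesBelow_ceil_subset_primesLE_floor y)
      have h1 : (0 : ℝ) ≤ (Nat.primeCounting ⌊y⌋₊ : ℝ) - #(Nat.primesBelow ⌈y⌉₊) := by
        rw [sub_nonneg]
        exact_mod_cast hle
      have h2 : 0 ≤ Real.log y := Real.log_nonneg hy
      positivity
    · filter_upwards [eventually_ge_atTop 1] with y hy
      have hle : (Nat.primeCounting ⌊y⌋₊ : ℝ) - #(Nat.primesBelow ⌈y⌉₊) ≤ 1 := by
        have h1 : Nat.primeCounting ⌊y⌋₊ - #(Nat.primesBelow ⌈y⌉₊) ≤ 1 := by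
          rw [← Nat.primesLE_card_eq_primeCounting,
            ← card_sdiff_of_subset (primesBelow_ceil_subset_primesLE_floor y)]
          exact (card_le_card (primesLE_floor_sdiff_subset (by linarith))).trans
            (card_singleton _).le
        have h2 : #(Nat.primesBelow ⌈y⌉₊) ≤ Nat.primeCounting ⌊y⌋₊ := by
          rw [← Nat.primesLE_card_eq_primeCounting]
          exact card_le_card (primesBelow_ceil_subset_primesLE_floor y)
        have : ((Nat.primeCounting ⌊y⌋₊ - #(Nat.primesBelow ⌈y⌉₊) : ℕ) : ℝ) ≤ 1 := by
          exact_mod_cast h1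
        rwa [Nat.cast_sub h2] at this
      have h2 : 0 ≤ Real.log y := Real.log_nonneg hy
      have hy0 : 0 < y := by linarith
      calc ((Nat.primeCounting ⌊y⌋₊ : ℝ) - #(Nat.primesBelow ⌈y⌉₊)) * Real.log y / y
          ≤ 1 * Real.log y / y := by gcongr
        _ = Real.log y / y := by rw [one_mul]
  have h := hπ.sub hdiff
  rw [sub_zero] at h
  exact h.congr' (Eventually.of_forall fun y => by ring)

/-- `#{p < cX} · log X / X → c` for `c > 0`. [folklore] -/
theorem tendsto_card_primesBelow_const_mul {c : ℝ} (hc : 0 < c) :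
    Tendsto (fun X : ℝ => (#(Nat.primesBelow ⌈c * X⌉₊) : ℝ) * Real.log X / X) atTop (𝓝 c) := by
  have h1 := tendsto_card_primesBelow_mul_log_div.comp (Tendsto.const_mul_atTop hc tendsto_id)
  have h2 : Tendsto (fun X : ℝ => Real.log X / Real.log (c * X)) atTop (𝓝 1) := by
    have h3 : Tendsto (fun X : ℝ => Real.log c / Real.log X + 1) atTop (𝓝 (0 + 1)) :=
      (tendsto_const_nhds.div_atTop Real.tendsto_log_atTop).add tendsto_const_nhds
    rw [zero_add] at h3
    have h4 := h3.inv₀ one_ne_zero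
    rw [inv_one] at h4
    refine h4.congr' ?_
    filter_upwards [eventually_gt_atTop 1] with X hX
    have hlogX : 0 < Real.log X := Real.log_pos hX
    have hcX : Real.log (c * X) = Real.log c + Real.log X :=
      Real.log_mul hc.ne' (by linarith)
    rw [hcX]
    field_simp
  have h := (h1.mul h2).const_mul c
  rw [mul_one, mul_one] at h
  refine h.congr' ?_
  filter_upwards [eventually_gt_atTop 1, (Tendsto.const_mul_atTop hc tendsto_id).eventually
    (eventually_gt_atTop 1)] with X hX hcX
  simp only [Function.comp_apply, id]
  have hlogX : 0 < Real.log X := Real.log_pos hX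
  have hlogcX : 0 < Real.log (c * X) := Real.log_pos hcX
  field_simp

/-- **The primes in `[2X, 4X)`**: `#{p : 2X ≤ p < 4X} · log X / X → 2` ("only the primes between
`2X` and `4X` are counted … `= 2X/log X + O(X/log² X)`"). [cite: Greaves2001, §4.5.1 p. 124] -/
theorem tendsto_card_primes_Ico_mul_log_div :
    Tendsto (fun X : ℝ => (#((Ico ⌈2 * X⌉₊ ⌈4 * X⌉₊).filter Nat.Prime) : ℝ) * Real.log X / X)
      atTop (𝓝 2) := by
  have h := (tendsto_card_primesBelow_const_mul (by norm_num : (0 : ℝ) < 4)).sub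
    (tendsto_card_primesBelow_const_mul (by norm_num : (0 : ℝ) < 2))
  rw [show (4 : ℝ) - 2 = 2 by norm_num] at h
  refine h.congr' ?_
  filter_upwards [eventually_ge_atTop 0] with X hX
  have hsub : Nat.primesBelow ⌈2 * X⌉₊ ⊆ Nat.primesBelow ⌈4 * X⌉₊ := fun p hp => by
    rw [Nat.mem_primesBelow] at hp ⊢
    exact ⟨hp.1.trans_le (Nat.ceil_mono (by linarith)), hp.2⟩
  rw [card_Ico_filter_prime hX, Nat.cast_sub (card_le_card hsub)]
  ring

/-! ### The limits `G_r(s) = e^{−γ} s φ_r(s)` on the initial ranges -/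

/-- `G_0(s) = e^{−γ} s F(s) = 2` for `0 < s ≤ 3` (`F(s) = 2e^γ/s`; `A₁ = 2/p₁(1)`,
`p₁(1) = e^{−γ}`). [cite: Greaves2001, p. 80 and Lemma 4.2.5 (4.11)] -/
theorem exp_neg_mul_mul_linearSievePhi_zero {s : ℝ} (hs0 : 0 < s) (hs : s ≤ 3) :
    Real.exp (-Real.eulerMascheroniConstant) * s * linearSievePhi 0 s = 2 := by
  rw [linearSievePhi_zero, Literature.NumberTheory.Sieve.LinearSieve.upperFun_eq hs,
    Literature.NumberTheory.Sieve.LinearSieve.const,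
    Literature.NumberTheory.Sieve.rosserAdjointP_one_one, Real.rpow_neg_one]
  have hexp : Real.exp (-Real.eulerMascheroniConstant) ≠ 0 := (Real.exp_pos _).ne'
  field_simp

/-- `G_1(s) = e^{−γ} s f(s) = 0` for `s ≤ 2` (`f(s) = 0`). [cite: Greaves2001, p. 80] -/
theorem exp_neg_mul_mul_linearSievePhi_one {s : ℝ} (hs : s ≤ 2) :
    Real.exp (-Real.eulerMascheroniConstant) * s * linearSievePhi 1 s = 0 := by
  rw [linearSievePhi_one, Literature.NumberTheory.Sieve.LinearSieve.lowerFun_eq hs, mul_zero]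

/-! ### The base cases (Special Situation) in the normalisation `S · log X / X` -/

/-- `X^{3/s − 1} → ∞` for `1 ≤ s < 3`: eventually `4X < (X^{1/s})³`. [folklore] -/
theorem eventually_four_mul_lt_rpow_cube {s : ℝ} (hs1 : 1 ≤ s) (hs3 : s < 3) :
    ∀ᶠ X : ℝ in atTop, 4 * X < (X ^ (1 / s)) ^ 3 := by
  have hs0 : 0 < s := by linarith
  have hexp : 0 < 3 / s - 1 := by
    rw [sub_pos, lt_div_iff₀ hs0]
    linarith
  have hlim : Tendsto (fun X : ℝ => X ^ (3 / s - 1)) atTop atTop := tendsto_rpow_atTop hexp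
  filter_upwards [hlim.eventually_gt_atTop 4, eventually_gt_atTop 0] with X hX hX0
  have hcube : (X ^ (1 / s)) ^ 3 = X * X ^ (3 / s - 1) := by
    rw [← Real.rpow_natCast, ← Real.rpow_mul hX0.le]
    rw [show (1 / s * ((3 : ℕ) : ℝ)) = 1 + (3 / s - 1) by push_cast; ring]
    rw [Real.rpow_add hX0, Real.rpow_one]
  rw [hcube]
  nlinarith

/-- **Base case `r = 1`, `1 ≤ s < 2`**: `S(𝒜⁻(X), P(X^{1/s})) log X / X → 0` — indeed the
left side vanishes for large `X` (`selbergSet_one_sifted_eq_zero`).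
[cite: Greaves2001, §4.5.1 "A Special Situation"] -/
theorem tendsto_sifted_one_of_lt_two {s : ℝ} (hs1 : 1 ≤ s) (hs2 : s < 2) :
    Tendsto (fun X : ℝ => (setSifted (selbergSet 1 X) (primesProdBelow (X ^ (1 / s))) : ℝ) *
      Real.log X / X) atTop (𝓝 0) := by
  refine tendsto_const_nhds.congr' ?_
  filter_upwards [eventually_four_mul_lt_rpow_sq hs1 hs2, eventually_ge_atTop 1] with X hX hX1
  rw [selbergSet_one_sifted_eq_zero hX1 (Real.rpow_pos_of_pos (by linarith) _) hX]
  simp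

/-- **Base case `r = 1`, `s = 2`** (the sifting limit itself): `S(𝒜⁻(X), P(√X)) log X / X → 0`.
The survivors are products of two primes in `[√X, 4√X)`, at most `π(4√X)²` of them
(`selbergSet_one_sifted_le_sq`), and `π(4√X) ≤ 8 (log 4 + 1) √X/log X` by Chebyshev's bound
(Mathlib's `Chebyshev.eventually_primeCounting_le`), so the quotient is `≤ 64 (log 4 + 1)²/log X`.
[cite: Greaves2001, §4.5.1 "A Special Situation"] -/
theorem tendsto_sifted_one_two :
    Tendsto (fun X : ℝ => (setSifted (selbergSet 1 X) (primesProdBelow (X ^ (1 / (2 : ℝ)))) : ℝ) *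
      Real.log X / X) atTop (𝓝 0) := by
  set C : ℝ := Real.log 4 + 1 with hC
  have hC0 : 0 < C := by
    have : 0 < Real.log 4 := Real.log_pos (by norm_num)
    linarith
  have hz_tend : Tendsto (fun X : ℝ => 4 * X ^ (1 / (2 : ℝ))) atTop atTop :=
    (tendsto_rpow_atTop (by norm_num)).const_mul_atTop (by norm_num)
  have hcheb := hz_tend.eventually (Chebyshev.eventually_primeCounting_le one_pos)
  have hup : Tendsto (fun X : ℝ => 64 * C ^ 2 / Real.log X) atTop (𝓝 0) :=
    tendsto_const_nhds.div_atTop Real.tendsto_log_atTop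
  refine squeeze_zero' ?_ ?_ hup
  · filter_upwards [eventually_ge_atTop 1] with X hX
    have : 0 ≤ Real.log X := Real.log_nonneg hX
    positivity
  · filter_upwards [hcheb, eventually_gt_atTop 4] with X hπ hX4
    have hX0 : 0 < X := by linarith
    have hX1 : 1 ≤ X := by linarith
    have hlogX : 0 < Real.log X := Real.log_pos (by linarith)
    set z : ℝ := X ^ (1 / (2 : ℝ)) with hz
    have hz0 : 0 < z := Real.rpow_pos_of_pos hX0 _
    have hz2 : z ^ 2 = X := by
      rw [hz, ← Real.rpow_natCast, ← Real.rpow_mul hX0.le]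
      norm_num
    have hz4 : 4 * X < z ^ 4 := by nlinarith
    have hS := selbergSet_one_sifted_le_sq hX1 hz0 hz4
    have h4Xz : 4 * X / z = 4 * z := by
      rw [← hz2]
      field_simp
    rw [h4Xz] at hS
    have hlogz : Real.log z = Real.log X / 2 := by
      rw [hz, Real.log_rpow hX0]
      ring
    have hlog4z : Real.log X / 2 ≤ Real.log (4 * z) := by
      rw [Real.log_mul (by norm_num) hz0.ne', hlogz]
      have : 0 ≤ Real.log 4 := Real.log_nonneg (by norm_num)
      linarith
    have hlog4z0 : 0 < Real.log (4 * z) := by linarith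
    -- Chebyshev: `π(4z) ≤ C (4z)/log(4z) ≤ 8 C z / log X`
    have hπ' : (Nat.primeCounting ⌊4 * z⌋₊ : ℝ) ≤ 8 * C * z / Real.log X := by
      calc (Nat.primeCounting ⌊4 * z⌋₊ : ℝ) ≤ C * (4 * z) / Real.log (4 * z) := hπ
        _ ≤ C * (4 * z) / (Real.log X / 2) := by
            gcongr
        _ = 8 * C * z / Real.log X := by
            field_simp
            ring
    have hπ0 : (0 : ℝ) ≤ Nat.primeCounting ⌊4 * z⌋₊ := Nat.cast_nonneg _
    have hS' : (setSifted (selbergSet 1 X) (primesProdBelow z) : ℝ) ≤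
        (8 * C * z / Real.log X) ^ 2 := by
      calc (setSifted (selbergSet 1 X) (primesProdBelow z) : ℝ)
          ≤ ((Nat.primeCounting ⌊4 * z⌋₊ : ℕ) : ℝ) ^ 2 := by exact_mod_cast hS
        _ ≤ (8 * C * z / Real.log X) ^ 2 := pow_le_pow_left₀ hπ0 hπ' 2
    calc (setSifted (selbergSet 1 X) (primesProdBelow z) : ℝ) * Real.log X / X
        ≤ (8 * C * z / Real.log X) ^ 2 * Real.log X / X := by gcongr
      _ = 64 * C ^ 2 / Real.log X := by
          field_simp
          nlinarith [hz2]

/-- **Base case `r = 0`, `1 ≤ s < 3`**: `S(𝒜⁺(X), P(X^{1/s})) log X / X → 2` — for large `X`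
the survivors are exactly the primes in `[2X, 4X)` (`selbergSet_zero_sifted_eq_card_primes`),
`2X/log X (1 + o(1))` of them. [cite: Greaves2001, §4.5.1 p. 124] -/
theorem tendsto_sifted_zero_of_lt_three {s : ℝ} (hs1 : 1 ≤ s) (hs3 : s < 3) :
    Tendsto (fun X : ℝ => (setSifted (selbergSet 0 X) (primesProdBelow (X ^ (1 / s))) : ℝ) *
      Real.log X / X) atTop (𝓝 2) := by
  refine tendsto_card_primes_Ico_mul_log_div.congr' ?_
  filter_upwards [eventually_four_mul_lt_rpow_cube hs1 hs3, eventually_ge_atTop 1] with X hX hX1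
  have hX0 : 0 < X := by linarith
  have hz : 0 < X ^ (1 / s) := Real.rpow_pos_of_pos hX0 _
  have hz2X : X ^ (1 / s) ≤ 2 * X := by
    have h1 : X ^ (1 / s) ≤ X ^ (1 : ℝ) :=
      Real.rpow_le_rpow_of_exponent_le hX1 (by rw [div_le_one (by linarith)]; exact hs1)
    rw [Real.rpow_one] at h1
    linarith
  rw [selbergSet_zero_sifted_eq_card_primes hX1 hz hX hz2X]

end Literature.Barriers.Parity
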